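import Summits.CriticalPhenomena.Ising3D.ExclusionSentencesTrg
import Summits.CriticalPhenomena.Ising3D.ExclusionSentencesLin

/-!
# Exclusion sentences — kernel-checked 2D-control and validation instances of the full `TRG` / `LIN` checkers
(cell `pub-ising3x`, seat recog-1)

HONEST FRAMING: lottery ticket; floor = tightest certified 3D Ising CFT bounds; no exact-solution
claim without a proof.

Instances of `trgExcluded` (`ExclusionSentencesTrg.lean`) and `linExcluded` (`ExclusionSentencesLin.lean`),
the checkers of the FAMILIES-v1 families `TRG` (no `Γ` factor) and `LIN` over their FULL constant sets
(`log 2, e, ζ(3), ζ(5), G` resp. `π, π², π³, log 2, ζ(3), ζ(5), G`):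
* 2D CONTROL (SCOPE.md §4; `Δ_σ = 1/8`).  TRG: at the full table bounds (`D ≤ 12`, `h ≤ 32`) NO `Γ`-free TRG
  form lies within `10⁻⁶` of `1/8` (empty list).  LIN (`H = 12`, the table): there ARE members within `10⁻⁶`
  of `1/8` — the kernel certifies the COMPLETE list: nine values, all resting on the two near-identities
  `3(π³ + ζ(3)) = 96.625003…` and `8 log 2 + 5G = 10.1250054…` (e.g. `(−96 + 3π³ + 3ζ(3))/5 = 0.12500060`,
  `(−9 + 8 log 2 + 5G)/9 = 0.12500060`); within `10⁻⁸` of `1/8` there is NONE — by REFINEMENT of the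
  complete list (`not_mem_linFamily_of_refine`: each listed value is decidably outside the narrower interval,
  no second table scan; `control_sigma_trg_lin`).  So for the 2D control the full LIN table is separated from
  `Δ_σ = 1/8` at eight certified digits, not at six — the kernel form of the protocol's rule R3 ("survives the
  next certified digit") for these members; at the blind round's widths they are exclusion data that fail
  R2 (SCOPE §3.4), never acceptances.
* VALIDATION against the Python twin `trglin_exceptions.py` (same enclosures and loops): on the window
  `[1.2020, 1.2021]` around `ζ(3)` the kernel accepts exactly the tool's lists — TRG (`h ≤ 8`) `{ζ(3)}`, LIN
  (`H ≤ 4`) `{ζ(3), (13 − 2π − 3ζ(5))/3}` — and rejects either list with `ζ(3)` removed (non-vacuity of the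
  new constants' branch).
The general REFINEMENT lemmas (`linTupleEncl`, `linTuplesOutside`, `not_mem_linFamily_of_refine`: a complete list
on `[a, b]` settles every sub-interval without a new table scan) are proved here, before their first use.
`Δ_ε = 1` instances live in `ExclusionSentencesControl2DZetaEps.lean`.  Kernel cost (measured on the farm):
TRG sentence ≈ 2.2× `TRGπ`; a full `H = 12` LIN sentence (scaled-integer leaf) — see the theorem docstrings.
No 3D digit is used anywhere.
-/

namespace Summit.CriticalPhenomena.Ising3D

/-! ### Refinement: a complete list on `[a, b]` settles every narrower interval for free -/

/-- Rational enclosure of a listed tuple's value `(a₀ + Σ cᵢKᵢ)/aₓ` (for `aₓ > 0`). -/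
def linTupleEncl (e : ℤ × List ℤ × ℕ) : ℚ × ℚ :=
  (((e.1 : ℚ) + (lin7Encl 0 e.2.1).1) / e.2.2, ((e.1 : ℚ) + (lin7Encl 0 e.2.1).2) / e.2.2)

/-- Soundness of `linTupleEncl`. -/
theorem lin7TupleVal_mem_encl (e : ℤ × List ℤ × ℕ) (he : 0 < e.2.2) :
    lin7TupleVal e ∈ InI (linTupleEncl e) := by
  obtain ⟨h1, h2⟩ := lin7Val_mem 0 e.2.1
  have he' : (0 : ℝ) < e.2.2 := by exact_mod_cast he
  refine ⟨?_, ?_⟩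
  · simp only [linTupleEncl, lin7TupleVal]; push_cast
    exact div_le_div_of_nonneg_right (by linarith) he'.le
  · simp only [linTupleEncl, lin7TupleVal]; push_cast
    exact div_le_div_of_nonneg_right (by linarith) he'.le

/-- Every listed tuple has `aₓ > 0` and a value decidably OUTSIDE `[a, b]`. -/
def linTuplesOutside (a b : ℚ) (ex : List (ℤ × List ℤ × ℕ)) : Bool :=
  ex.all fun e => decide (0 < e.2.2) && (decide ((linTupleEncl e).2 < a) || decide (b < (linTupleEncl e).1))

/-- Soundness of `linTuplesOutside`. -/
theorem linTuplesOutside_sound {a b : ℚ} {ex : List (ℤ × List ℤ × ℕ)} (h : linTuplesOutside a b ex = true)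
    {e : ℤ × List ℤ × ℕ} (he : e ∈ ex) : ¬((a : ℝ) ≤ lin7TupleVal e ∧ lin7TupleVal e ≤ b) := by
  unfold linTuplesOutside at h
  have h1 := List.all_eq_true.mp h e he
  simp only [Bool.and_eq_true, Bool.or_eq_true, decide_eq_true_eq] at h1
  obtain ⟨he0, h2⟩ := h1
  obtain ⟨hv1, hv2⟩ := lin7TupleVal_mem_encl e he0
  rintro ⟨hx1, hx2⟩
  rcases h2 with h2 | h2
  · have h3 : (((linTupleEncl e).2 : ℚ) : ℝ) < (a : ℝ) := Rat.cast_lt.mpr h2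
    linarith
  · have h3 : ((b : ℚ) : ℝ) < (((linTupleEncl e).1 : ℚ) : ℝ) := Rat.cast_lt.mpr h2
    linarith

/-- **Refinement.** A complete member list on `[a, b]` (`linExcluded H a b ex = true`) whose tuples all lie
decidably outside a sub-interval `[a', b'] ⊆ [a, b]` proves that `[a', b']` contains NO member of
`linFamily H` — no new table scan needed (the protocol's "next certified digit", rule R3, in kernel form). -/
theorem not_mem_linFamily_of_refine {H : ℕ} {a b a' b' : ℚ} {ex : List (ℤ × List ℤ × ℕ)}
    (hc : linExcluded H a b ex = true) (ha : a ≤ a') (hb : b' ≤ b)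
    (hout : linTuplesOutside a' b' ex = true) {x : ℝ} (hx : (a' : ℝ) ≤ x ∧ x ≤ b') :
    x ∉ linFamily H := by
  intro hm
  have ha' : ((a : ℚ) : ℝ) ≤ a' := Rat.cast_le.mpr ha
  have hb' : ((b' : ℚ) : ℝ) ≤ b := Rat.cast_le.mpr hb
  obtain ⟨e, he, hxe⟩ := linExcluded_sound hc ⟨ha'.trans hx.1, hx.2.trans hb'⟩ hm
  exact linTuplesOutside_sound hout he (hxe ▸ hx)

/-! ### `Δ_σ = 1/8`: TRG empty at six digits; LIN complete member list at six digits, empty at eight -/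

/-- No `Γ`-free TRG form (`D ≤ 12`, `h ≤ 32`, `L ∈ {log 2, e, ζ(3), ζ(5), G}`) lies in
`[1/8 − 10⁻⁶, 1/8 + 10⁻⁶]`. -/
theorem trgExcluded_control_sigma :
    trgExcluded 12 32 (1 / 8 - 1 / 10 ^ 6) (1 / 8 + 1 / 10 ^ 6) [] = true := by
  decide +kernel

/-- The LIN members (`H ≤ 12`, all seven constants) within `10⁻⁶` of `1/8`: nine tuples
`(a₀, [c_π, c_{π²}, c_{π³}, c_{log 2}, c_{ζ(3)}, c_{ζ(5)}, c_G], aₓ)`, seven on `3(π³ + ζ(3)) ≈ 96 + 5/8` and two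
on `8 log 2 + 5G ≈ 10 + 1/8`. -/
def controlSigmaLinEx : List (ℤ × List ℤ × ℕ) :=
  [(387, [0, 0, -12, 0, -12, 0, 0], 4), (97, [0, 0, -3, 0, -3, 0, 0], 3), (98, [0, 0, -3, 0, -3, 0, 0], 11),
   (-96, [0, 0, 3, 0, 3, 0, 0], 5), (-193, [0, 0, 6, 0, 6, 0, 0], 2), (-289, [0, 0, 9, 0, 9, 0, 0], 7),
   (-385, [0, 0, 12, 0, 12, 0, 0], 12), (11, [0, 0, 0, -8, 0, 0, -5], 7), (-9, [0, 0, 0, 8, 0, 0, 5], 9)]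

/-- Part 0 of the `H = 12` LIN sentence on `[1/8 − 10⁻⁶, 1/8 + 10⁻⁶]` (one kernel evaluation). -/
theorem linExcluded_control_sigma6_p0 :
    linExcludedPart 12 0 (1 / 8 - 1 / 10 ^ 6) (1 / 8 + 1 / 10 ^ 6) controlSigmaLinEx = true := by
  decide +kernel

/-- Part 1 of the `H = 12` LIN sentence on `[1/8 − 10⁻⁶, 1/8 + 10⁻⁶]` (one kernel evaluation). -/
theorem linExcluded_control_sigma6_p1 :
    linExcludedPart 12 1 (1 / 8 - 1 / 10 ^ 6) (1 / 8 + 1 / 10 ^ 6) controlSigmaLinEx = true := by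
  decide +kernel

/-- Part 2 of the `H = 12` LIN sentence on `[1/8 − 10⁻⁶, 1/8 + 10⁻⁶]` (one kernel evaluation). -/
theorem linExcluded_control_sigma6_p2 :
    linExcludedPart 12 2 (1 / 8 - 1 / 10 ^ 6) (1 / 8 + 1 / 10 ^ 6) controlSigmaLinEx = true := by
  decide +kernel

/-- Part 3 of the `H = 12` LIN sentence on `[1/8 − 10⁻⁶, 1/8 + 10⁻⁶]` (one kernel evaluation). -/
theorem linExcluded_control_sigma6_p3 :
    linExcludedPart 12 3 (1 / 8 - 1 / 10 ^ 6) (1 / 8 + 1 / 10 ^ 6) controlSigmaLinEx = true := by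
  decide +kernel

/-- LIN sentence (`H = 12`, all seven constants) on `[1/8 − 10⁻⁶, 1/8 + 10⁻⁶]`: the nine listed tuples are
the COMPLETE member list (assembled from the four parts). -/
theorem linExcluded_control_sigma6 :
    linExcluded 12 (1 / 8 - 1 / 10 ^ 6) (1 / 8 + 1 / 10 ^ 6) controlSigmaLinEx = true :=
  linExcluded_of_parts linExcluded_control_sigma6_p0 linExcluded_control_sigma6_p1
    linExcluded_control_sigma6_p2 linExcluded_control_sigma6_p3

/-- Each of the nine members lies decidably OUTSIDE `[1/8 − 10⁻⁸, 1/8 + 10⁻⁸]` (their deviations from `1/8`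
are `6·10⁻⁸ … 7.5·10⁻⁷`). -/
theorem linTuplesOutside_control_sigma8 :
    linTuplesOutside (1 / 8 - 1 / 10 ^ 8) (1 / 8 + 1 / 10 ^ 8) controlSigmaLinEx = true := by
  decide +kernel

/-- Printed shape for `Δ_σ`: a real within `10⁻⁶` of `1/8` is no `Γ`-free TRG form (`D ≤ 12`, `h ≤ 32`), and
if it is a LIN member of height `≤ 12` it is one of the nine listed values; within `10⁻⁸` of `1/8` it is no
LIN member at all (by refinement of the complete list — no second table scan). -/
theorem control_sigma_trg_lin {x : ℝ}
    (hx : ((1 / 8 - 1 / 10 ^ 6 : ℚ) : ℝ) ≤ x ∧ x ≤ ((1 / 8 + 1 / 10 ^ 6 : ℚ) : ℝ)) :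
    x ∉ trgFamily 12 32 ∧ (x ∈ linFamily 12 → ∃ e ∈ controlSigmaLinEx, x = lin7TupleVal e) ∧
      (((1 / 8 - 1 / 10 ^ 8 : ℚ) : ℝ) ≤ x ∧ x ≤ ((1 / 8 + 1 / 10 ^ 8 : ℚ) : ℝ) → x ∉ linFamily 12) := by
  refine ⟨fun hm => ?_, fun hm => linExcluded_sound linExcluded_control_sigma6 hx hm, fun hx8 => ?_⟩
  · obtain ⟨e, he, _⟩ := trgExcluded_sound trgExcluded_control_sigma hx hm
    simp at he
  · exact not_mem_linFamily_of_refine linExcluded_control_sigma6 (by norm_num) (by norm_num)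
      linTuplesOutside_control_sigma8 hx8

/-! ### Validation window around `ζ(3)`: the new constants' branch is exercised and agrees with the tool -/

/-- TRG exception tuples on `[1.2020, 1.2021]` with `h ≤ 8`: `ζ(3)` itself (`(1, 1, 0, 0, 2, 1)`). -/
def zeta3WindowTrgEx : List (ℕ × ℕ × ℕ × ℤ × ℕ × ℤ) :=
  [(1, 1, 0, 0, 2, 1)]

/-- TRG sentence (`D ≤ 12`, `h ≤ 8`) on `[1.2020, 1.2021]`. -/
theorem trgExcluded_zeta3Window :
    trgExcluded 12 8 (12020 / 10000) (12021 / 10000) zeta3WindowTrgEx = true := by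
  decide +kernel

/-- … and the sentence with `ζ(3)` removed is rejected (the checker does find the member). -/
theorem trgExcluded_zeta3Window_minimal :
    trgExcluded 12 8 (12020 / 10000) (12021 / 10000) [] = false := by
  decide +kernel

/-- LIN exception tuples on `[1.2020, 1.2021]` with `H ≤ 4`: `ζ(3)` and `(13 − 2π − 3ζ(5))/3`. -/
def zeta3WindowLinEx : List (ℤ × List ℤ × ℕ) :=
  [(0, [0, 0, 0, 0, 1, 0, 0], 1), (13, [-2, 0, 0, 0, 0, -3, 0], 3)]

/-- LIN sentence (`H ≤ 4`) on `[1.2020, 1.2021]`. -/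
theorem linExcluded_zeta3Window :
    linExcluded 4 (12020 / 10000) (12021 / 10000) zeta3WindowLinEx = true := by
  decide +kernel

/-- … and the sentence with `ζ(3)` removed from the list is rejected. -/
theorem linExcluded_zeta3Window_minimal :
    linExcluded 4 (12020 / 10000) (12021 / 10000) [(13, [-2, 0, 0, 0, 0, -3, 0], 3)] = false := by
  decide +kernel

/-- The value of the first validation tuple is `ζ(3)` (reading check of the tuple conventions). -/
theorem zeta3Window_first_val : lin7TupleVal (0, [0, 0, 0, 0, 1, 0, 0], 1) = zeta3 := by
  simp [lin7TupleVal, lin7Val, k7Val]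

end Summit.CriticalPhenomena.Ising3D
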